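import Mathlib.GroupTheory.SpecificGroups.Cyclic
import Mathlib.Topology.Algebra.OpenSubgroup
import Literature.IUT.HodgeTheaters.PuncturedEllipticCoveringsCusps
import HarnessLib

/-!
# [IUTchI] §1: the Galois action on the cusps of `X̲` — derived facts (proof-only companion)

Mochizuki, *Inter-universal Teichmüller theory I*, kurims manuscript (May 2020), §1 p. 37–38
([IUTchI] §1 pp.37–38) [claim: Mochizuki2012, status: disputed] (D-0012 claim key, series status
DISPUTED — pure group theory over the interface `PuncturedEllipticData.CuspGalois` of
`PuncturedEllipticCoveringsCusps.lean`; nothing of the series is asserted), with [EtTh] Def. 2.1 /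
Rmk. 2.1.1 p. 33.

KERNEL-CHECKED CONSEQUENCES of the laws of `C : D.CuspGalois` (the items (b), (d) of GAP-LEDGER
G-L5t4g3-1 = abc-iut-L5-t4's interface request IR-A, and the bookkeeping abc-iut-L5-t4's P5-binding of
[IUTchI] Def. 6.1 (iii)/(v) consumes):
* `act_apply_eq_self_of_mem_PiXbar`, `act_eq_one_of_mem_PiXbar` — `Π_X̲` acts trivially on the cusps of `X̲`;
* `mem_PiXbar_iff_act_eq_one` — for `g ∈ Π_X`: `g ∈ Π_X̲ ↔ g` acts trivially ((b): `Gal(X̲/X) = Π_X/Π_X̲`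
  acts faithfully); `act_eq_act_of_apply_eq` — elements of `Π_X` agreeing on one cusp agree everywhere;
* `ker_actX` — `Ker(Π_X → Perm Cusp(X̲)) = Π_X̲`; `normal_PiXbar_subgroupOf` ((d): `Π_X̲ ⊴ Π_X`) and
  `normal_PiXbar` (`Π_X̲ ⊴ Π_C`: `X̲ → C` is Galois, group `Q ⋊ {±1} = 𝔽_l^{⋊±}` of Def. 6.1 (v));
* `act_eq_act` — any two companions have the same `act` (the datum is determined by the frozen data);
* `exists_quotientEquivCusp`, `card_cusp`, `finite_cusp` — the orbit map `Π_X/Π_X̲ ⥲ Cusp(X̲)` at `ε⁰`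
  is a bijection, `#Cusp(X̲) = [Π_X : Π_X̲]` (`= l` by [IUTchI] Def. 3.1 (d)), finitely many cusps;
* `isCyclic_quotient` ((d): `Gal(X̲/X) = Π_X/Π_X̲` is cyclic);
* `act_conj_eq_inv`, `act_act_of_mem_PiCbar` — `ι̲ g ι̲⁻¹ = g⁻¹` on cusps ([EtTh] Rmk. 2.1.1);
  `act_inv_ε0_eq_ε2` — `ε″ = g₁⁻¹·ε⁰` whenever `g₁·ε⁰ = ε′` (`ε′, ε″ = ±1` for the origin `ε⁰`);
  `act_twoε_orbit` — `ι̲ (g₁²·ε⁰) = g₁⁻²·ε⁰` (`{2ε′, 2ε″}` is an `ι̲`-orbit, the fibre over `2ε̲`).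
PROOF-ONLY: no definition, no instance, no notation; axioms standard. No side taken on [IUTchIII] Cor. 3.12.
-/

namespace Literature.IUT.HodgeTheaters

namespace PuncturedEllipticData

open scoped Pointwise
open Topology Literature.AnabelianGeometry.AbsoluteAnabelian

universe u

variable {D : PuncturedEllipticData.{u}}

namespace CuspGalois

variable (C : D.CuspGalois)

/-- `act_decomp` with the two conjugations separated: `D_{g·x} = t·(g·D_x·g⁻¹)·t⁻¹` for some `t ∈ Π_X̲`.
([IUTchI] §1 p.37) [claim: Mochizuki2012, status: disputed] -/
theorem act_decomp' (g : D.PiC) (x : D.Cusp) :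
    ∃ t ∈ D.PiXbar, MulAut.conj t • (MulAut.conj g • D.decomp x) = D.decomp (C.act g x) := by
  obtain ⟨t, ht, h⟩ := C.act_decomp g x
  exact ⟨t, ht, by rwa [← mul_smul, ← map_mul]⟩

/-- `Π_X̲` acts trivially on the cusps of `X̲` (its elements conjugate `D_x` within its own `Π_X̲`-class).
([IUTchI] §1 p.37) [claim: Mochizuki2012, status: disputed] -/
theorem act_apply_eq_self_of_mem_PiXbar {g : D.PiC} (hg : g ∈ D.PiXbar) (x : D.Cusp) :
    C.act g x = x := by
  obtain ⟨t, ht, h⟩ := C.act_decomp g x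
  exact (C.eq_of_conj x (C.act g x) (t * g) (D.PiXbar.mul_mem ht hg) h).symm

/-- `Π_X̲ ≤ Ker(act)`. ([IUTchI] §1 p.37) [claim: Mochizuki2012, status: disputed] -/
theorem act_eq_one_of_mem_PiXbar {g : D.PiC} (hg : g ∈ D.PiXbar) : C.act g = 1 :=
  Equiv.ext fun x => C.act_apply_eq_self_of_mem_PiXbar hg x

/-- **(G-L5t4g3-1 (b))** for `g ∈ Π_X`: `g ∈ Π_X̲ ↔ g` acts trivially on the cusps of `X̲` (the kernel of
the action of `Π_X` is exactly `Π_X̲`, i.e. `Gal(X̲/X) = Π_X/Π_X̲` acts faithfully).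
([IUTchI] §1 p.37) [claim: Mochizuki2012, status: disputed] -/
theorem mem_PiXbar_iff_act_eq_one {g : D.PiC} (hg : g ∈ D.PiX) : g ∈ D.PiXbar ↔ C.act g = 1 :=
  ⟨fun h => C.act_eq_one_of_mem_PiXbar h, fun h => C.free g hg D.ε0 (by rw [h]; rfl)⟩

/-- Two elements of `Π_X` that agree on ONE cusp induce the same permutation (freeness).
([IUTchI] §1 p.37) [claim: Mochizuki2012, status: disputed] -/
theorem act_eq_act_of_apply_eq {g g' : D.PiC} (hg : g ∈ D.PiX) (hg' : g' ∈ D.PiX) (x : D.Cusp)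
    (h : C.act g x = C.act g' x) : C.act g = C.act g' := by
  have hmem : g⁻¹ * g' ∈ D.PiXbar := by
    refine C.free _ (D.PiX.mul_mem (D.PiX.inv_mem hg) hg') x ?_
    rw [map_mul, map_inv, Equiv.Perm.mul_apply, ← h, Equiv.Perm.inv_def, Equiv.symm_apply_apply]
  have h1 := C.act_eq_one_of_mem_PiXbar hmem
  rw [map_mul, map_inv, inv_mul_eq_one] at h1
  exact h1

/-- **`Ker(Π_X → Perm Cusp(X̲)) = Π_X̲`** (as a subgroup of `Π_X`).
([IUTchI] §1 p.37) [claim: Mochizuki2012, status: disputed] -/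
theorem ker_actX : C.actX.ker = D.PiXbar.subgroupOf D.PiX := by
  ext g
  rw [MonoidHom.mem_ker, Subgroup.mem_subgroupOf, actX_apply]
  exact (C.mem_PiXbar_iff_act_eq_one g.2).symm

include C in
/-- **(G-L5t4g3-1 (d))** `Π_X̲ ⊴ Π_X` (`X̲ → X` is Galois). ([IUTchI] §1 p.37) [claim: Mochizuki2012, status: disputed] -/
theorem normal_PiXbar_subgroupOf : (D.PiXbar.subgroupOf D.PiX).Normal := by
  rw [← C.ker_actX]
  infer_instance

include C in
/-- `Π_X̲ ⊴ Π_C`: `X̲ → C` is Galois (`Π_X̲ = Ker(act) ∩ Π_X` with `Π_X ⊴ Π_C` of index `2`).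
([IUTchI] §1 p.37) [claim: Mochizuki2012, status: disputed] -/
theorem normal_PiXbar : D.PiXbar.Normal := by
  refine ⟨fun n hn g => ?_⟩
  have hX : g * n * g⁻¹ ∈ D.PiX := D.piX_normal.conj_mem n hn.1 g
  refine (C.mem_PiXbar_iff_act_eq_one hX).mpr ?_
  rw [map_mul, map_mul, C.act_eq_one_of_mem_PiXbar hn, mul_one, ← map_mul, mul_inv_cancel, map_one]

/-- Any two companions have THE SAME action: `act` is determined by the frozen data (the
decomposition groups up to `Π_X̲`-conjugacy distinguish the cusps). ([IUTchI] §1 p.37)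
[claim: Mochizuki2012, status: disputed] -/
theorem act_eq_act (C' : D.CuspGalois) : C.act = C'.act := by
  refine MonoidHom.ext fun g => Equiv.ext fun x => ?_
  obtain ⟨t, ht, h⟩ := C.act_decomp' g x
  obtain ⟨t', ht', h'⟩ := C'.act_decomp' g x
  -- `D_{C g x} = t g D_x g⁻¹ t⁻¹` and `D_{C' g x} = t' g D_x g⁻¹ t'⁻¹`, so they are `Π_X̲`-conjugate by `t' t⁻¹`
  refine C.eq_of_conj _ _ (t' * t⁻¹) (D.PiXbar.mul_mem ht' (D.PiXbar.inv_mem ht)) ?_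
  rw [← h, ← h', map_mul, mul_smul, map_inv, inv_smul_smul]

/-! ### The orbit map `Π_X/Π_X̲ ⥲ Cusp(X̲)` -/

/-- **`Π_X/Π_X̲ ⥲ Cusp(X̲)`, `g ↦ g·ε⁰`**: the orbit map at the zero cusp is a well-defined bijection from the
coset space `Π_X/Π_X̲` (free + transitive = simply transitive: the cusps of `X̲` form a torsor under
`Gal(X̲/X)`). ([IUTchI] §1 p.37) [claim: Mochizuki2012, status: disputed] -/
theorem exists_quotientEquivCusp : ∃ e : D.PiX ⧸ D.PiXbar.subgroupOf D.PiX ≃ D.Cusp,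
    ∀ g : D.PiX, e (g : D.PiX ⧸ D.PiXbar.subgroupOf D.PiX) = C.act (g : D.PiC) D.ε0 := by
  let f : D.PiX ⧸ D.PiXbar.subgroupOf D.PiX → D.Cusp :=
    Quotient.lift (fun g : D.PiX => C.act (g : D.PiC) D.ε0) fun a b hab => by
      have hab' : a⁻¹ * b ∈ D.PiXbar.subgroupOf D.PiX := QuotientGroup.leftRel_apply.mp hab
      rw [Subgroup.mem_subgroupOf, Subgroup.coe_mul, Subgroup.coe_inv] at hab'
      have h := C.act_apply_eq_self_of_mem_PiXbar hab' D.ε0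
      rw [map_mul, map_inv, Equiv.Perm.mul_apply, Equiv.Perm.inv_def, Equiv.symm_apply_eq] at h
      exact h.symm
  have hf : ∀ g : D.PiX, f (g : D.PiX ⧸ D.PiXbar.subgroupOf D.PiX) = C.act (g : D.PiC) D.ε0 :=
    fun _ => rfl
  have hbij : Function.Bijective f := by
    constructor
    · intro a b
      induction a using QuotientGroup.induction_on with | H a => ?_
      induction b using QuotientGroup.induction_on with | H b => ?_
      intro h
      rw [hf, hf] at h
      rw [QuotientGroup.eq, Subgroup.mem_subgroupOf, Subgroup.coe_mul, Subgroup.coe_inv]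
      refine C.free _ (D.PiX.mul_mem (D.PiX.inv_mem a.2) b.2) D.ε0 ?_
      rw [map_mul, map_inv, Equiv.Perm.mul_apply, ← h, Equiv.Perm.inv_def, Equiv.symm_apply_apply]
    · intro y
      obtain ⟨g, hg, hgy⟩ := C.transitive D.ε0 y
      exact ⟨((⟨g, hg⟩ : D.PiX) : D.PiX ⧸ D.PiXbar.subgroupOf D.PiX), hgy⟩
  exact ⟨Equiv.ofBijective f hbij, hf⟩

include C in
/-- `#Cusp(X̲) = [Π_X : Π_X̲]` (`= deg(X̲/X)`; `= l` is [IUTchI] Def. 3.1 (d), abc-iut-L5-t2's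
`ThetaGeometry.PiXbar_relIndex`). ([IUTchI] §1 p.37) [claim: Mochizuki2012, status: disputed] -/
theorem card_cusp : Nat.card D.Cusp = D.PiXbar.relIndex D.PiX := by
  obtain ⟨e, -⟩ := C.exists_quotientEquivCusp
  exact (Nat.card_congr e).symm

/-- `Π_X̲` is open in `Π_X` (it is `Π_X ∩ Π_C̲`). ([IUTchI] §1 p.37) [claim: Mochizuki2012, status: disputed] -/
theorem isOpen_PiXbar_subgroupOf : IsOpen (D.PiXbar.subgroupOf D.PiX : Set D.PiX) := by
  have h : (D.PiXbar.subgroupOf D.PiX : Set D.PiX) = Subtype.val ⁻¹' (D.PiXbar : Set D.PiC) := rfl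
  rw [h]
  exact (continuous_subtype_val.isOpen_preimage _ (D.isOpen_piX.inter D.isOpen_piCbar))

include C in
/-- The cusps of `X̲` are finite in number (`[Π_X : Π_X̲] < ∞`: `Π_X̲` is open in the profinite `Π_X`).
([IUTchI] §1 p.37) [claim: Mochizuki2012, status: disputed] -/
theorem finite_cusp : Finite D.Cusp := by
  haveI : Finite (D.PiX ⧸ D.PiXbar.subgroupOf D.PiX) :=
    Subgroup.quotient_finite_of_isOpen' D.PiX (D.PiXbar.subgroupOf D.PiX) D.isOpen_piX
      (isOpen_PiXbar_subgroupOf (D := D))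
  obtain ⟨e, -⟩ := C.exists_quotientEquivCusp
  exact Finite.of_equiv _ e

include C in
/-- **(G-L5t4g3-1 (d))** `Gal(X̲/X) = Π_X/Π_X̲` is cyclic ("`≅ Q`, a free `ℤ/lℤ`-module of rank `1`").
([IUTchI] §1 p.37) [claim: Mochizuki2012, status: disputed] -/
theorem isCyclic_quotient : ∀ [(D.PiXbar.subgroupOf D.PiX).Normal],
    IsCyclic (D.PiX ⧸ D.PiXbar.subgroupOf D.PiX) := by
  intro _
  obtain ⟨g, hg, hgen⟩ := C.exists_generator
  refine ⟨⟨((⟨g, hg⟩ : D.PiX) : D.PiX ⧸ D.PiXbar.subgroupOf D.PiX), fun q => ?_⟩⟩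
  induction q using QuotientGroup.induction_on with | H h => ?_
  obtain ⟨n, hn⟩ := hgen h h.2
  refine ⟨n, ?_⟩
  dsimp only
  rw [← QuotientGroup.mk_zpow, QuotientGroup.eq, Subgroup.mem_subgroupOf, Subgroup.coe_mul,
    Subgroup.coe_inv, SubgroupClass.coe_zpow]
  refine (C.mem_PiXbar_iff_act_eq_one
    (D.PiX.mul_mem (D.PiX.inv_mem (D.PiX.zpow_mem hg n)) h.2)).mpr ?_
  rw [map_mul, map_inv, map_zpow, ← hn, inv_mul_cancel]

/-! ### The involution `ι̲` -/

/-- **`ι̲ ∘ g = g⁻¹ ∘ ι̲` on the cusps of `X̲`** for `g ∈ Π_X` and `ι̲ =` any `c ∈ Π_C̲ ∖ Π_X̲` ([EtTh] Rmk. 2.1.1: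
"`ι̲` acts on `Q` by multiplication by `−1`"; the dihedral relation of `Gal(X̲/C) ≅ 𝔽_l^{⋊±}`, [IUTchI]
Def. 6.1 (v)). ([IUTchI] §1 p.37) [claim: Mochizuki2012, status: disputed] -/
theorem act_conj_eq_inv {c g : D.PiC} (hc : c ∈ D.PiCbar) (hcX : c ∉ D.PiX) (hg : g ∈ D.PiX) :
    C.act c * C.act g * (C.act c)⁻¹ = (C.act g)⁻¹ := by
  have h := C.act_eq_one_of_mem_PiXbar (C.conj_mul_mem_PiXbar c hc hcX g hg)
  rw [map_mul, map_mul, map_mul, map_inv, mul_eq_one_iff_eq_inv] at h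
  exact h

/-- `ι̲ (g·x) = g⁻¹·(ι̲ x)` (pointwise form of `act_conj_eq_inv`). ([IUTchI] §1 p.37)
[claim: Mochizuki2012, status: disputed] -/
theorem act_act_of_mem_PiCbar {c g : D.PiC} (hc : c ∈ D.PiCbar) (hcX : c ∉ D.PiX) (hg : g ∈ D.PiX)
    (x : D.Cusp) : C.act c (C.act g x) = C.act g⁻¹ (C.act c x) := by
  have h := congrArg (fun σ : Equiv.Perm D.Cusp => σ (C.act c x)) (C.act_conj_eq_inv hc hcX hg)
  simp only [Equiv.Perm.mul_apply, Equiv.Perm.inv_def, Equiv.symm_apply_apply] at h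
  rw [h, map_inv, Equiv.Perm.inv_def]

/-- **`ε″ = (−1)·ε⁰`-translate: if `g₁ ∈ Π_X` carries `ε⁰` to `ε′`, then `g₁⁻¹` carries `ε⁰` to `ε″`**
(`ε′, ε″ = ±ε` in the torsor with origin `ε⁰`; needs SOME `ι̲ ∈ Π_C̲ ∖ Π_X̲`, which exists as soon as
`Π_C̲ ⊄ Π_X`, e.g. under abc-iut-L5-t2's `ThetaGeometry.not_PiCbar_le_PiX`).
([IUTchI] §1 p.37) [claim: Mochizuki2012, status: disputed] -/
theorem act_inv_ε0_eq_ε2 (hι : ¬ D.PiCbar ≤ D.PiX) {g : D.PiC} (hg : g ∈ D.PiX)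
    (h1 : C.act g D.ε0 = D.ε1) : C.act g⁻¹ D.ε0 = D.ε2 := by
  obtain ⟨c, hc, hcX⟩ := SetLike.not_le_iff_exists.mp hι
  have h := C.act_act_of_mem_PiCbar hc hcX hg D.ε0
  rw [h1, C.act_ε1 c hc hcX, C.act_ε0 c hc] at h
  exact h.symm

/-- With origin `ε⁰` and `ε′ = g₁·ε⁰`: the chosen cusp over `2ε̲` is `g₁²·ε⁰` or `g₁⁻²·ε⁰`, and these two are
switched by `ι̲` (so `{2ε′, 2ε″}` is an `ι̲`-orbit, the fibre over the cusp `2ε̲` of `C̲`).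
([IUTchI] §1 p.38) [claim: Mochizuki2012, status: disputed] -/
theorem act_twoε_orbit {c g : D.PiC} (hc : c ∈ D.PiCbar) (hcX : c ∉ D.PiX) (hg : g ∈ D.PiX) :
    C.act c (C.act (g * g) D.ε0) = C.act (g⁻¹ * g⁻¹) D.ε0 := by
  rw [C.act_act_of_mem_PiCbar hc hcX (D.PiX.mul_mem hg hg), C.act_ε0 c hc, mul_inv_rev]

end CuspGalois

end PuncturedEllipticData

end Literature.IUT.HodgeTheaters
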